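import Summits.Ventures.HSemireg.WedgeHankelRecurrenceGaussChebyshevCassini
import Literature.Algebra.Polynomial.ChebyshevExplicitForms
import Literature.Algebra.Polynomial.ChebyshevCoefficientFormulas

/-!
# Venture HSemireg — **EXPLICIT BÉZOUT IDENTITIES `T_n U_n − T_{n+1} U_{n−1} = 1` AND `T_{n+1} U_n − T_{n+2} U_{n−1} = X`** (Mathlib's Chebyshev polynomials, all `n ∈ ℤ`, any commutative ring):
# hence **consecutive `T_{n+1}`, `T_n` are coprime in `R[X]` for EVERY commutative ring `R`** (coefficients `−U_{n−1}`, `U_n`), and likewise the pairs `(T_n, U_{n−1})`, `(U_n, U_{n−1})`,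
# `(T_{n+1}, U_n)` — the ideal-theoretic form of «consecutive orthogonal polynomials have no common zero»

HONEST FRAMING. Part of the Lean index of the computation cell `pub-hsemireg` (seat p10 gen 47, Sunday typer «UNIFORM-IN-n»).  Polynomial algebra only; no variety, no cohomology theory, no
sheaf, no Ext group and no semiregularity map is constructed here; nothing here says that HC / HC_CM / HC_AV holds; no Literature fact (unproved `Prop`) is declared or used.  Custodian versions as
in `WedgeHankelSiegelIdeal` (1/3).
SOURCES (cited).  T. J. Rivlin, *Chebyshev Polynomials* (1990), §1.2, Ex. 1.2.15(e), Ex. 1.5.15; J. C. Mason, D. C. Handscomb, *Chebyshev Polynomials* (2003), §1.2; G. Szegő, *Orthogonal Polynomials*, §3.3.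
The first identity and the `T`-coprimality come from the landed Literature files (imported); the second identity by the telescoping induction of N445.
PROOF TYPED HERE.  `Literature…U_add_eq_U_mul_T_add_T_mul_U R n (−n)` with Mathlib `T_neg`, `U_neg_sub_one`; `Polynomial.Chebyshev.induct` for the second identity (`E_{n+1} − E_n = 0` by Mathlib
`U_add_two`, `T_add_two`, `T_add_one`, `U_sub_two`); `Literature…isCoprime_chebyshevT_succ`.
DEDUP DISCLOSURE (`rg -n -i 'bezout|isCoprime_chebyshevT|U_add_eq' Summits Literature`, 2026-09-04): `Literature…ChebyshevCoefficientFormulas.isCoprime_chebyshevT_succ` (consecutive `T`, all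
`n ∈ ℤ`, any ring — used below, not re-proved) and `not_isRoot_chebyshevT_succ`; `Literature…ChebyshevExplicitForms.U_add_eq_U_mul_T_add_T_mul_U` (its instance `a = n, n ↦ −n` is the first
Bézout identity below); N443 `chebyshev_isCoprime_T_U`, N445 `chebyshev_isCoprime_U_succ`; the second identity (`= X`), the pair `(T_n, U_{n−1})` and the evaluation corollary are new; 0 hits for
the 5 names below.

WHAT IS IN THE TREE.  `Literature…U_add_eq_U_mul_T_add_T_mul_U`, `isCoprime_chebyshevT_succ`; N438 `chebyshevT_mul_U`; N443, N445 as above; Mathlib recurrences.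
THIS FILE (namespace `Summit.Ventures.HSemireg.Wedge.HankelOuter` continued; CHAINED on N445; 0 definitions):
* §1211 `chebyshevTU_bezout_one` (`T_nU_n − T_{n+1}U_{n−1} = 1`, from the Literature addition formula), **`chebyshevTU_bezout_X`** (`T_{n+1}U_n − T_{n+2}U_{n−1} = X`), `chebyshev_isCoprime_T_succ` (Literature, symmetric form),
  `chebyshev_isCoprime_T_U_pred` (`IsCoprime T_n U_{n−1}`), `chebyshevT_eval_mul_U_eval_at_zero` (`T_n(x)U_n(x) = 1` at zeros of `T_{n+1}`).
CAVEATS.  Nothing Ext-side.  New names only.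
-/

open Module Polynomial
open scoped Matrix Polynomial

namespace Summit.Ventures.HSemireg.Wedge.HankelOuter

/-! ## §1211. Bézout identities for consecutive Chebyshev polynomials -/

/-- **`T_n U_n − T_{n+1} U_{n−1} = 1`** (all `n ∈ ℤ`, any commutative ring) — the instance `a = n`, `n ↦ −n` of the LANDED addition formula
`Literature.Algebra.Polynomial.ChebyshevExplicitForms.U_add_eq_U_mul_T_add_T_mul_U` (`U_{a+n} = U_a T_n + T_{a+1} U_{n−1}`, Rivlin Ex. 1.2.15(e)) with `T_{−n} = T_n`, `U_{−n−1} = −U_{n−1}`.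
[Rivlin §1.2; this file, §1211] -/
theorem chebyshevTU_bezout_one {R : Type*} [CommRing R] (n : ℤ) :
    Polynomial.Chebyshev.T R n * Polynomial.Chebyshev.U R n - Polynomial.Chebyshev.T R (n + 1) * Polynomial.Chebyshev.U R (n - 1) = 1 := by
  have h := Literature.Algebra.Polynomial.ChebyshevExplicitForms.U_add_eq_U_mul_T_add_T_mul_U R n (-n)
  rw [add_neg_cancel, Polynomial.Chebyshev.U_zero, Polynomial.Chebyshev.T_neg, Polynomial.Chebyshev.U_neg_sub_one] at h
  linear_combination -h

/-- **`T_{n+1} U_n − T_{n+2} U_{n−1} = X`** (all `n ∈ ℤ`, any commutative ring). [Rivlin §1.2; this file, §1211] -/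
theorem chebyshevTU_bezout_X {R : Type*} [CommRing R] (n : ℤ) :
    Polynomial.Chebyshev.T R (n + 1) * Polynomial.Chebyshev.U R n - Polynomial.Chebyshev.T R (n + 2) * Polynomial.Chebyshev.U R (n - 1) = Polynomial.X := by
  induction n using Polynomial.Chebyshev.induct with
  | zero => simp only [zero_add, zero_sub, Polynomial.Chebyshev.T_one, Polynomial.Chebyshev.U_zero, Polynomial.Chebyshev.T_two, Polynomial.Chebyshev.U_neg_one]; ring
  | one =>
    rw [Polynomial.Chebyshev.T_add_two R 1, show (1 : ℤ) + 1 = 2 by norm_num, show (1 : ℤ) - 1 = 0 by norm_num, Polynomial.Chebyshev.T_one, Polynomial.Chebyshev.U_one,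
      Polynomial.Chebyshev.T_two, Polynomial.Chebyshev.U_zero]; ring
  | add_two n ih1 ih2 =>
    have hU := Polynomial.Chebyshev.U_add_two R (n : ℤ)
    have hT := Polynomial.Chebyshev.T_add_two R ((n : ℤ) + 2)
    linear_combination (norm := ring_nf) ih1 + Polynomial.Chebyshev.T R ((n : ℤ) + 3) * hU - Polynomial.Chebyshev.U R ((n : ℤ) + 1) * hT
  | neg_add_one n ih1 ih2 =>
    have hT := Polynomial.Chebyshev.T_add_one R (-(n : ℤ) + 1)
    have hU := Polynomial.Chebyshev.U_sub_two R (-(n : ℤ))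
    linear_combination (norm := ring_nf) ih1 + Polynomial.Chebyshev.U R (-(n : ℤ) - 1) * hT - Polynomial.Chebyshev.T R (-(n : ℤ) + 1) * hU

/-- **Consecutive `T_{n+1}`, `T_n` are coprime in `R[X]` for every commutative ring `R`** — this is (the symmetric form of) the LANDED
`Literature.Algebra.Polynomial.ChebyshevCoefficientFormulas.isCoprime_chebyshevT_succ` (Rivlin Ex. 1.5.15); the explicit Bézout coefficients are `−U_{n−1}`, `U_n` by `chebyshevTU_bezout_one`.
[corollary; Szegő §3.3; this file, §1211] -/
theorem chebyshev_isCoprime_T_succ {R : Type*} [CommRing R] (n : ℤ) : IsCoprime (Polynomial.Chebyshev.T R (n + 1)) (Polynomial.Chebyshev.T R n) :=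
  (Literature.Algebra.Polynomial.ChebyshevCoefficientFormulas.isCoprime_chebyshevT_succ R n).symm

/-- **`T_n` and `U_{n−1}` are coprime** (Bézout: `U_n T_n + (−T_{n+1}) U_{n−1} = 1`). [corollary; this file, §1211] -/
theorem chebyshev_isCoprime_T_U_pred {R : Type*} [CommRing R] (n : ℤ) : IsCoprime (Polynomial.Chebyshev.T R n) (Polynomial.Chebyshev.U R (n - 1)) :=
  ⟨Polynomial.Chebyshev.U R n, -Polynomial.Chebyshev.T R (n + 1), by linear_combination chebyshevTU_bezout_one (R := R) n⟩

/-- At a zero `x` of `T_{n+1}`: **`T_n(x) U_n(x) = 1`** (so `T_n(x)` and `U_n(x)` are units, in particular nonzero in a nontrivial ring). [corollary; this file, §1211] -/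
theorem chebyshevT_eval_mul_U_eval_at_zero {R : Type*} [CommRing R] (n : ℤ) {x : R} (hx : (Polynomial.Chebyshev.T R (n + 1)).eval x = 0) :
    (Polynomial.Chebyshev.T R n).eval x * (Polynomial.Chebyshev.U R n).eval x = 1 := by
  have h := congrArg (Polynomial.eval x) (chebyshevTU_bezout_one (R := R) n)
  simp only [eval_sub, eval_mul, eval_one, hx, zero_mul, sub_zero] at h
  exact h

end Summit.Ventures.HSemireg.Wedge.HankelOuter
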